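import Summits.Schanuel.Schanuel.Theorems.SoloInformedRoyWindow
import Literature.NumberTheory.Transcendental.RoyCriterionProp2Proofs
import Literature.NumberTheory.Transcendental.RoyCriterionProp3Proofs
import Literature.NumberTheory.Transcendental.RoyCriterionThm3Proofs
import HarnessLib

/-!
# Roy's criterion: single-point smallness holds at every point of `ℂ²`

(solo seat `solo-Schanuel-informed`, session 4; sequel to `SoloInformedRoySinglePoint`.)

Roy's Theorem 1 [Roy2001] — the engine of his reformulation of Schanuel's conjecture
(`Roy2001_iff`) — says that for `α ≠ 0` the pair `(y, α)` lies on the graph of `exp` up to torsion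
(condition (a): `α^d = e^{dy}` for some `d ≥ 1`) iff condition (b) holds: for all large `N` some
non-zero `Q_N ∈ ℤ[X₀, X₁]` with `deg Q_N ≤ (N^{t₀}, N^{t₁})`, `H(Q_N) ≤ e^N` satisfies
`|(D^k Q_N)(my, α^m)| ≤ e^{-N^u}` for all `k ≤ N^{s₀}` and all translates `1 ≤ m ≤ N^{s₁}`.

`SoloInformedRoySinglePoint` proved, at the special points `(0, 1/c)`, that the `m = 1` part of (b)
alone is satisfiable off the graph.  This file proves the general fact:

* `eventually_exists_roySmallAt_everywhere` — for every `(y, α) ∈ ℂ²` and every admissible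
  parameter quintuple, for all large `N` Roy's box contains `Q_N ≠ 0` with
  `|(D^k Q_N)(y, α)| ≤ e^{-N^u}` for all `k ≤ N^{s₀}` (stated in the expanded form of
  `RoyConditionB` with the quantifier over `m` removed; in the notation of
  `SoloInformedRoySinglePoint` it reads `(royBox t₀ t₁ N ∩ roySmallAt y α s₀ u N).Nonempty`);
* `roy_translates_carry_all_content` — juxtaposed with Theorem 1 (tree: `Roy2001_thm1_holds`):
  the single-point part of (b) carries no information about `(y, α)`; all of the arithmetic content
  of Roy's criterion sits in the simultaneous smallness along the translates `m = 2, …, N^{s₁}`.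

## Proof

Dirichlet's box principle for real linear forms (`exists_ne_zero_int_forms_le`, in the tree) applied
to the `2(K+1)` forms `t ↦ Re, Im (D^k Q_t)(y, α)`, `k ≤ K = ⌊N^{s₀}⌋`, `Q_t = Σ t_{ab} X₀^a X₁^b`,
in the `(⌊N^{t₀}⌋+1)(⌊N^{t₁}⌋+1) > N^{t₀+t₁}` unknowns `|t_{ab}| ≤ ⌊e^N⌋`.  The coefficients
`(D^k X₀^a X₁^b)(y, α)` are the derivatives at `s = 0` of `s ↦ (y+s)^a (α e^s)^b` (the flow of
`D = ∂₀ + X₁∂₁` through `(y, α)`, tree: `iteratedDeriv_aeval_add_mul_exp`), so Cauchy's estimate on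
`|s| = 1` bounds them by `k! (1+|y|)^a (e(1+|α|))^b` (`norm_aeval_iterate_royD_monoXY_le`).  With
`ℓ = ⌈2 X M K! G e^{N^u}⌉` boxes per form the pigeon-hole count `ℓ^{2(K+1)} < (X+1)^M` reduces to
`4 N^{s₀} (2 log 4 + (1+t₀+t₁) N + (s₀/ε) N^{s₀+ε} + L_y N^{t₀} + L_α N^{t₁} + N^u) < N^{1+t₀+t₁}`,
true for large `N` because `s₀ + u < 1 + t₀ + t₁` in Roy's window (`royAdmissible_add_lt_one_add`)
together with `1 < s₀ < u`, `t₀, t₁ < s₀` (`eventually_box_numerics`).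
-/

noncomputable section

open MvPolynomial Filter Complex Metric
open Literature.NumberTheory.Transcendental

namespace Summit.Schanuel.Schanuel.Theorems

/-! ### The evaluation functionals `Q ↦ (D^k Q)(y, α)` on the coefficient box -/

/-- `(D^k Q_t)(y, α) = Σ_{ab} t_{ab} · (D^k X₀^a X₁^b)(y, α)`: a linear form in the coefficient
vector `t`. [folklore] -/
theorem aeval_iterate_royD_polyOfCoeffs {T₀ T₁ : ℕ} (k : ℕ)
    (t : Fin (T₀ + 1) × Fin (T₁ + 1) → ℤ) (y α : ℂ) :
    aeval ![y, α] (royD^[k] (polyOfCoeffs t)) =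
      ∑ ab, (t ab : ℂ) * aeval ![y, α] (royD^[k] (monoXY ab.1 ab.2)) := by
  rw [polyOfCoeffs, iterate_royD_sum, map_sum]
  refine Finset.sum_congr rfl fun ab _ => ?_
  rw [iterate_royD_C_mul, map_mul, aeval_C]
  simp

/-- Cauchy bound for the monomial coefficients along the flow `s ↦ (y + s, α e^s)` of `D`:
`|(D^k X₀^a X₁^b)(y, α)| ≤ k! (1 + |y|)^a (e (1 + |α|))^b`. [folklore; cf. Roy2001, §4 (p. 191)] -/
theorem norm_aeval_iterate_royD_monoXY_le (k a b : ℕ) (y α : ℂ) :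
    ‖aeval ![y, α] (royD^[k] (monoXY a b))‖ ≤
      k.factorial * ((1 + ‖y‖) ^ a * (Real.exp 1 * (1 + ‖α‖)) ^ b) := by
  set f : ℂ → ℂ := fun s => aeval ![y + s, α * cexp s] (monoXY a b) with hf
  have hdiff : Differentiable ℂ f := fun s =>
    (hasDerivAt_aeval_add_mul_exp (monoXY a b) y α s).differentiableAt
  have hval : aeval ![y, α] (royD^[k] (monoXY a b)) = iteratedDeriv k f 0 := by
    rw [hf, iteratedDeriv_aeval_add_mul_exp]
    simp
  have hC : ∀ s ∈ sphere (0 : ℂ) 1, ‖f s‖ ≤ (1 + ‖y‖) ^ a * (Real.exp 1 * (1 + ‖α‖)) ^ b := by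
    intro s hs
    have hs1 : ‖s‖ = 1 := by simpa using hs
    have h1 : f s = (y + s) ^ a * (α * cexp s) ^ b := by
      simp [hf, monoXY, map_mul, map_pow]
    rw [h1, norm_mul, norm_pow, norm_pow, norm_mul]
    have hy : ‖y + s‖ ≤ 1 + ‖y‖ := by
      calc ‖y + s‖ ≤ ‖y‖ + ‖s‖ := norm_add_le _ _
        _ = 1 + ‖y‖ := by rw [hs1, add_comm]
    have hα : ‖α‖ * ‖cexp s‖ ≤ Real.exp 1 * (1 + ‖α‖) := by
      have he : ‖cexp s‖ ≤ Real.exp 1 := by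
        rw [Complex.norm_exp]
        exact Real.exp_le_exp.2 ((re_le_norm s).trans hs1.le)
      calc ‖α‖ * ‖cexp s‖ ≤ (1 + ‖α‖) * Real.exp 1 :=
            mul_le_mul (by linarith [norm_nonneg α]) he (norm_nonneg _) (by positivity)
        _ = Real.exp 1 * (1 + ‖α‖) := mul_comm _ _
    gcongr
  have h := Complex.norm_iteratedDeriv_le_of_forall_mem_sphere_norm_le (f := f) k one_pos
    hdiff.diffContOnCl hC
  rw [hval]
  simpa using h

/-! ### Numerics in Roy's window -/

/-- The exponent inequalities used by the box-principle construction, extracted from window (1):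
`0 < t₀`, `0 < t₁`, `1 < s₀`, `t₀ < s₀`, `t₁ < s₀`, `s₀ < u`, `s₀ + u < 1 + t₀ + t₁`.
[cite: Roy2001, §1 (1)] -/
theorem royAdmissible_box_facts {s₀ s₁ t₀ t₁ u : ℝ} (h : RoyAdmissible s₀ s₁ t₀ t₁ u) :
    0 < t₀ ∧ 0 < t₁ ∧ 1 < s₀ ∧ t₀ < s₀ ∧ t₁ < s₀ ∧ s₀ < u ∧ s₀ + u < 1 + t₀ + t₁ := by
  obtain ⟨⟨-, -, ht₀, ht₁, -⟩, ⟨h1, h2, h3, -, -, -⟩, ⟨h7, -, h9⟩⟩ := royAdmissible_iff.mp h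
  exact ⟨ht₀, ht₁, h1, h2, by linarith, h7, by linarith⟩

/-- Growth bookkeeping for the box principle (`σ = 1 + t₀ + t₁`, `ε = (σ - 2s₀)/2`): eventually
`4 x^{s₀} (2 log 4 + σ x + (s₀/ε) x^{s₀+ε} + L_y x^{t₀} + L_α x^{t₁} + x^u) < x^σ`, i.e.
`#forms · log ℓ < #unknowns · log (X + 1)`. [folklore] -/
theorem eventually_box_numerics {s₀ s₁ t₀ t₁ u : ℝ} (h : RoyAdmissible s₀ s₁ t₀ t₁ u)
    (Ly Lα : ℝ) :
    ∀ᶠ x : ℝ in atTop, 1 ≤ x ∧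
      4 * x ^ s₀ * (2 * Real.log 4 + (1 + t₀ + t₁) * x +
        s₀ / ((1 + t₀ + t₁ - 2 * s₀) / 2) * x ^ (s₀ + (1 + t₀ + t₁ - 2 * s₀) / 2) +
        Ly * x ^ t₀ + Lα * x ^ t₁ + x ^ u) < x ^ (1 + t₀ + t₁) := by
  obtain ⟨ht₀, ht₁, hs₀, ht₀s, ht₁s, hsu, hsum⟩ := royAdmissible_box_facts h
  set σ : ℝ := 1 + t₀ + t₁ with hσ
  set ε : ℝ := (σ - 2 * s₀) / 2 with hε
  have hε0 : 0 < ε := by rw [hε]; linarith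
  have q : (0 : ℝ) < 1 / 7 := by norm_num
  have A₁ := eventually_mul_rpow_le_mul_rpow (8 * Real.log 4) (show s₀ < σ by linarith) q
  have A₂ := eventually_mul_rpow_le_mul_rpow (4 * σ) (show s₀ + 1 < σ by linarith) q
  have A₃ := eventually_mul_rpow_le_mul_rpow (4 * (s₀ / ε))
    (show 2 * s₀ + ε < σ by rw [hε]; linarith) q
  have A₄ := eventually_mul_rpow_le_mul_rpow (4 * Ly) (show s₀ + t₀ < σ by linarith) q
  have A₅ := eventually_mul_rpow_le_mul_rpow (4 * Lα) (show s₀ + t₁ < σ by linarith) q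
  have A₆ := eventually_mul_rpow_le_mul_rpow 4 hsum q
  filter_upwards [eventually_ge_atTop 1, A₁, A₂, A₃, A₄, A₅, A₆] with x hx B₁ B₂ B₃ B₄ B₅ B₆
  refine ⟨hx, ?_⟩
  have hx0 : 0 < x := one_pos.trans_le hx
  have hxσ : 0 < x ^ σ := Real.rpow_pos_of_pos hx0 _
  have e1 : x ^ s₀ * x = x ^ (s₀ + 1) := by rw [Real.rpow_add hx0, Real.rpow_one]
  have e2 : x ^ s₀ * x ^ (s₀ + ε) = x ^ (2 * s₀ + ε) := by
    rw [← Real.rpow_add hx0]; ring_nf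
  have e3 : x ^ s₀ * x ^ t₀ = x ^ (s₀ + t₀) := by rw [Real.rpow_add hx0]
  have e4 : x ^ s₀ * x ^ t₁ = x ^ (s₀ + t₁) := by rw [Real.rpow_add hx0]
  have e5 : x ^ s₀ * x ^ u = x ^ (s₀ + u) := by rw [Real.rpow_add hx0]
  have expand : 4 * x ^ s₀ * (2 * Real.log 4 + σ * x + s₀ / ε * x ^ (s₀ + ε) + Ly * x ^ t₀ +
      Lα * x ^ t₁ + x ^ u) = 8 * Real.log 4 * x ^ s₀ + 4 * σ * x ^ (s₀ + 1) +
      4 * (s₀ / ε) * x ^ (2 * s₀ + ε) + 4 * Ly * x ^ (s₀ + t₀) + 4 * Lα * x ^ (s₀ + t₁) +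
      4 * x ^ (s₀ + u) := by
    rw [← e1, ← e2, ← e3, ← e4, ← e5]; ring
  rw [expand]
  linarith

/-! ### Single-point smallness everywhere -/

/-- **Single-point smallness holds everywhere.** For every `(y, α) ∈ ℂ²` and every admissible
`(s₀, s₁, t₀, t₁, u)`, for all large `N` there is `Q_N ≠ 0` in Roy's box (`deg ≤ (N^{t₀}, N^{t₁})`,
`H(Q_N) ≤ e^N`) with `|(D^k Q_N)(y, α)| ≤ e^{-N^u}` for all `k ≤ N^{s₀}`.
[folklore: Dirichlet's box principle, cf. Waldschmidt1981, Lemme 3.3; Roy2001, Thm. 1] -/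
theorem eventually_exists_roySmallAt_everywhere (y α : ℂ) {s₀ s₁ t₀ t₁ u : ℝ}
    (h : RoyAdmissible s₀ s₁ t₀ t₁ u) :
    ∀ᶠ N : ℕ in atTop, ∃ Q : MvPolynomial (Fin 2) ℤ, Q ≠ 0 ∧
      (Q.degreeOf 0 : ℝ) ≤ (N : ℝ) ^ t₀ ∧ (Q.degreeOf 1 : ℝ) ≤ (N : ℝ) ^ t₁ ∧
      (mvPolyHeight Q : ℝ) ≤ Real.exp N ∧
      ∀ k : ℕ, (k : ℝ) ≤ (N : ℝ) ^ s₀ → ‖aeval ![y, α] (royD^[k] Q)‖ ≤ Real.exp (-(N : ℝ) ^ u) := by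
  obtain ⟨ht₀, ht₁, hs₀, ht₀s, ht₁s, hsu, hsum⟩ := royAdmissible_box_facts h
  set Ly : ℝ := Real.log (1 + ‖y‖) with hLy
  set Lα : ℝ := 1 + Real.log (1 + ‖α‖) with hLα
  have h1y : (1 : ℝ) ≤ 1 + ‖y‖ := by linarith [norm_nonneg y]
  have h1α' : (1 : ℝ) ≤ 1 + ‖α‖ := by linarith [norm_nonneg α]
  have h1α : (1 : ℝ) ≤ Real.exp 1 * (1 + ‖α‖) :=
    one_le_mul_of_one_le_of_one_le (Real.one_le_exp zero_le_one) h1α'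
  have hLy0 : 0 ≤ Ly := Real.log_nonneg h1y
  have hLα0 : 0 ≤ Lα := by
    have := Real.log_nonneg h1α'
    rw [hLα]; linarith
  filter_upwards [tendsto_natCast_atTop_atTop.eventually (eventually_box_numerics h Ly Lα)]
    with N hN
  set ε : ℝ := (1 + t₀ + t₁ - 2 * s₀) / 2 with hε
  have hε0 : 0 < ε := by rw [hε]; linarith
  obtain ⟨hx1, hmain⟩ := hN
  set x : ℝ := (N : ℝ) with hxdef
  have hx0 : 0 < x := one_pos.trans_le hx1
  set T₀ : ℕ := ⌊x ^ t₀⌋₊ with hT₀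
  set T₁ : ℕ := ⌊x ^ t₁⌋₊ with hT₁
  set K : ℕ := ⌊x ^ s₀⌋₊ with hK
  set X : ℕ := ⌊Real.exp x⌋₊ with hX
  have hT₀le : (T₀ : ℝ) ≤ x ^ t₀ := Nat.floor_le (Real.rpow_nonneg hx0.le _)
  have hT₁le : (T₁ : ℝ) ≤ x ^ t₁ := Nat.floor_le (Real.rpow_nonneg hx0.le _)
  have hKle : (K : ℝ) ≤ x ^ s₀ := Nat.floor_le (Real.rpow_nonneg hx0.le _)
  have hT₀lt : x ^ t₀ ≤ (T₀ : ℝ) + 1 := (Nat.lt_floor_add_one _).le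
  have hT₁lt : x ^ t₁ ≤ (T₁ : ℝ) + 1 := (Nat.lt_floor_add_one _).le
  have hXle : (X : ℝ) ≤ Real.exp x := Nat.floor_le (Real.exp_pos x).le
  have hXlt : Real.exp x < (X : ℝ) + 1 := Nat.lt_floor_add_one _
  have hX1R : (1 : ℝ) ≤ X := by exact_mod_cast Nat.floor_pos.2 (Real.one_le_exp hx0.le)
  have h1r : ∀ {r : ℝ}, 0 ≤ r → (1 : ℝ) ≤ x ^ r := fun hr => Real.one_le_rpow hx1 hr
  have h1s₀ := h1r (le_of_lt (one_pos.trans hs₀))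
  -- the number of boxes per form
  set B : ℝ := 2 * X * (((T₀ + 1) * (T₁ + 1) : ℕ) : ℝ) * K.factorial *
    ((1 + ‖y‖) ^ T₀ * (Real.exp 1 * (1 + ‖α‖)) ^ T₁) * Real.exp (x ^ u) with hB
  have hM1 : (1 : ℝ) ≤ (((T₀ + 1) * (T₁ + 1) : ℕ) : ℝ) := by
    exact_mod_cast Nat.one_le_iff_ne_zero.2 (by positivity)
  have hKf1 : (1 : ℝ) ≤ (K.factorial : ℝ) := by exact_mod_cast Nat.one_le_iff_ne_zero.2 (Nat.factorial_ne_zero K)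
  have hG1 : (1 : ℝ) ≤ (1 + ‖y‖) ^ T₀ * (Real.exp 1 * (1 + ‖α‖)) ^ T₁ :=
    one_le_mul_of_one_le_of_one_le (one_le_pow₀ h1y) (one_le_pow₀ h1α)
  have hE1 : (1 : ℝ) ≤ Real.exp (x ^ u) := Real.one_le_exp (Real.rpow_nonneg hx0.le _)
  have hB2 : (2 : ℝ) ≤ B := by
    rw [hB]
    calc (2 : ℝ) = 2 * 1 * 1 * 1 * 1 * 1 := by norm_num
      _ ≤ 2 * X * (((T₀ + 1) * (T₁ + 1) : ℕ) : ℝ) * K.factorial *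
          ((1 + ‖y‖) ^ T₀ * (Real.exp 1 * (1 + ‖α‖)) ^ T₁) * Real.exp (x ^ u) := by
          gcongr
  have hB0 : 0 < B := by linarith
  set ℓ : ℕ := ⌈B⌉₊ with hℓ
  have hℓpos : 0 < ℓ := Nat.ceil_pos.2 hB0
  have hℓposR : (0 : ℝ) < ℓ := by exact_mod_cast hℓpos
  have hBℓ : B ≤ ℓ := Nat.le_ceil B
  have hℓ2B : (ℓ : ℝ) ≤ 2 * B := by
    have := Nat.ceil_lt_add_one hB0.le
    rw [← hℓ] at this
    linarith
  -- `log ℓ ≤ 2 log 4 + σ x + (s₀/ε) x^{s₀+ε} + L_y x^{t₀} + L_α x^{t₁} + x^u`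
  have hMexp : (((T₀ + 1) * (T₁ + 1) : ℕ) : ℝ) ≤ Real.exp (Real.log 4 + (t₀ + t₁) * x) := by
    have h1 : (((T₀ + 1) * (T₁ + 1) : ℕ) : ℝ) ≤ 4 * x ^ (t₀ + t₁) := by
      push_cast
      have a1 : (T₀ : ℝ) + 1 ≤ 2 * x ^ t₀ := by linarith [h1r ht₀.le]
      have a2 : (T₁ : ℝ) + 1 ≤ 2 * x ^ t₁ := by linarith [h1r ht₁.le]
      calc ((T₀ : ℝ) + 1) * ((T₁ : ℝ) + 1) ≤ (2 * x ^ t₀) * (2 * x ^ t₁) :=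
            mul_le_mul a1 a2 (by positivity) (by positivity)
        _ = 4 * x ^ (t₀ + t₁) := by rw [Real.rpow_add hx0]; ring
    have h2 : x ^ (t₀ + t₁) ≤ Real.exp ((t₀ + t₁) * x) := by
      rw [Real.rpow_def_of_pos hx0, mul_comm]
      refine Real.exp_le_exp.2 (mul_le_mul_of_nonneg_left ?_ (by linarith))
      linarith [Real.log_le_sub_one_of_pos hx0]
    calc (((T₀ + 1) * (T₁ + 1) : ℕ) : ℝ) ≤ 4 * x ^ (t₀ + t₁) := h1
      _ ≤ 4 * Real.exp ((t₀ + t₁) * x) := by linarith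
      _ = Real.exp (Real.log 4 + (t₀ + t₁) * x) := by
          rw [Real.exp_add, Real.exp_log (by norm_num)]
  have hKexp : (K.factorial : ℝ) ≤ Real.exp (s₀ / ε * x ^ (s₀ + ε)) := by
    have h1 : (K.factorial : ℝ) ≤ (K : ℝ) ^ K := by exact_mod_cast Nat.factorial_le_pow K
    have h2 : Real.log (K.factorial : ℝ) ≤ K * Real.log K := by
      rw [← Real.log_pow]; exact Real.log_le_log (by positivity) h1
    have h3 : (K : ℝ) * Real.log K ≤ s₀ / ε * x ^ (s₀ + ε) := by
      rcases Nat.eq_zero_or_pos K with hK0 | hKpos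
      · rw [hK0]; simp only [Nat.cast_zero, zero_mul]
        exact (mul_pos (div_pos (by linarith) hε0) (Real.rpow_pos_of_pos hx0 _)).le
      · have hK1 : (1 : ℝ) ≤ K := by exact_mod_cast hKpos
        have h4 : Real.log K ≤ s₀ * (x ^ ε / ε) := by
          calc Real.log K ≤ Real.log (x ^ s₀) := Real.log_le_log (by linarith) hKle
            _ = s₀ * Real.log x := Real.log_rpow hx0 s₀
            _ ≤ s₀ * (x ^ ε / ε) :=
                mul_le_mul_of_nonneg_left (Real.log_le_rpow_div hx0.le hε0) (by linarith)
        calc (K : ℝ) * Real.log K ≤ x ^ s₀ * (s₀ * (x ^ ε / ε)) :=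
              mul_le_mul hKle h4 (Real.log_nonneg hK1) (Real.rpow_nonneg hx0.le _)
          _ = s₀ / ε * x ^ (s₀ + ε) := by rw [Real.rpow_add hx0]; field_simp
    calc (K.factorial : ℝ) = Real.exp (Real.log (K.factorial : ℝ)) :=
          (Real.exp_log (by positivity)).symm
      _ ≤ Real.exp (s₀ / ε * x ^ (s₀ + ε)) := Real.exp_le_exp.2 (h2.trans h3)
  have hGexp : (1 + ‖y‖) ^ T₀ * (Real.exp 1 * (1 + ‖α‖)) ^ T₁ ≤
      Real.exp (Ly * x ^ t₀ + Lα * x ^ t₁) := by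
    have g1 : (1 + ‖y‖) ^ T₀ = Real.exp (T₀ * Ly) := by
      rw [hLy, Real.exp_nat_mul, Real.exp_log (by positivity)]
    have g2 : (Real.exp 1 * (1 + ‖α‖)) ^ T₁ = Real.exp (T₁ * Lα) := by
      rw [hLα, Real.exp_nat_mul, Real.exp_add, Real.exp_log (by positivity)]
    rw [g1, g2, ← Real.exp_add]
    refine Real.exp_le_exp.2 (add_le_add ?_ ?_)
    · calc (T₀ : ℝ) * Ly ≤ x ^ t₀ * Ly := mul_le_mul_of_nonneg_right hT₀le hLy0
        _ = Ly * x ^ t₀ := mul_comm _ _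
    · calc (T₁ : ℝ) * Lα ≤ x ^ t₁ * Lα := mul_le_mul_of_nonneg_right hT₁le hLα0
        _ = Lα * x ^ t₁ := mul_comm _ _
  have h4 : (4 : ℝ) ≤ Real.exp (Real.log 4) := by rw [Real.exp_log (by norm_num)]
  have hℓexp : (ℓ : ℝ) ≤ Real.exp (2 * Real.log 4 + (1 + t₀ + t₁) * x +
      s₀ / ε * x ^ (s₀ + ε) + Ly * x ^ t₀ + Lα * x ^ t₁ + x ^ u) := by
    calc (ℓ : ℝ) ≤ 2 * B := hℓ2B
      _ = 4 * X * (((T₀ + 1) * (T₁ + 1) : ℕ) : ℝ) * K.factorial *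
          ((1 + ‖y‖) ^ T₀ * (Real.exp 1 * (1 + ‖α‖)) ^ T₁) * Real.exp (x ^ u) := by
          rw [hB]; ring
      _ ≤ Real.exp (Real.log 4) * Real.exp x * Real.exp (Real.log 4 + (t₀ + t₁) * x) *
          Real.exp (s₀ / ε * x ^ (s₀ + ε)) * Real.exp (Ly * x ^ t₀ + Lα * x ^ t₁) *
          Real.exp (x ^ u) := by
          gcongr
      _ = Real.exp (2 * Real.log 4 + (1 + t₀ + t₁) * x +
          s₀ / ε * x ^ (s₀ + ε) + Ly * x ^ t₀ + Lα * x ^ t₁ + x ^ u) := by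
          simp only [← Real.exp_add]; congr 1; ring
  have hlogℓ := (Real.log_le_log hℓposR hℓexp).trans_eq (Real.log_exp _)
  have hlogℓ0 : 0 ≤ Real.log ℓ := Real.log_nonneg (by exact_mod_cast hℓpos)
  -- the pigeon-hole count `ℓ^{2(K+1)} < (X+1)^{(T₀+1)(T₁+1)}`
  have hK4 : (((K + 1) * 2 : ℕ) : ℝ) ≤ 4 * x ^ s₀ := by push_cast; linarith
  have hlhs : (((K + 1) * 2 : ℕ) : ℝ) * Real.log ℓ < x ^ (1 + t₀ + t₁) := by
    calc (((K + 1) * 2 : ℕ) : ℝ) * Real.log ℓ ≤ 4 * x ^ s₀ * Real.log ℓ :=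
          mul_le_mul_of_nonneg_right hK4 hlogℓ0
      _ ≤ 4 * x ^ s₀ * (2 * Real.log 4 + (1 + t₀ + t₁) * x +
          s₀ / ε * x ^ (s₀ + ε) + Ly * x ^ t₀ + Lα * x ^ t₁ + x ^ u) :=
          mul_le_mul_of_nonneg_left hlogℓ (by positivity)
      _ < x ^ (1 + t₀ + t₁) := hmain
  have hrhs : x ^ (1 + t₀ + t₁) ≤ (((T₀ + 1) * (T₁ + 1) : ℕ) : ℝ) * Real.log ((X : ℝ) + 1) := by
    have hMge : x ^ (t₀ + t₁) ≤ (((T₀ + 1) * (T₁ + 1) : ℕ) : ℝ) := by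
      rw [Real.rpow_add hx0]; push_cast
      exact mul_le_mul hT₀lt hT₁lt (Real.rpow_nonneg hx0.le _) (by positivity)
    have hlogX1 : x ≤ Real.log ((X : ℝ) + 1) := by
      rw [Real.le_log_iff_exp_le (by positivity)]; exact hXlt.le
    calc x ^ (1 + t₀ + t₁) = x ^ (t₀ + t₁) * x := by
          rw [show (1 + t₀ + t₁ : ℝ) = (t₀ + t₁) + 1 by ring, Real.rpow_add hx0, Real.rpow_one]
      _ ≤ (((T₀ + 1) * (T₁ + 1) : ℕ) : ℝ) * Real.log ((X : ℝ) + 1) :=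
          mul_le_mul hMge hlogX1 hx0.le (by positivity)
  have hcardR : (ℓ : ℝ) ^ ((K + 1) * 2) < ((X : ℝ) + 1) ^ ((T₀ + 1) * (T₁ + 1)) := by
    rw [← Real.exp_log hℓposR, ← Real.exp_log (by positivity : (0 : ℝ) < (X : ℝ) + 1),
      ← Real.exp_nat_mul, ← Real.exp_nat_mul]
    exact Real.exp_lt_exp.2 (hlhs.trans_le hrhs)
  have hcard : ℓ ^ ((K + 1) * 2) < (X + 1) ^ ((T₀ + 1) * (T₁ + 1)) := by exact_mod_cast hcardR
  -- the real linear forms: real and imaginary parts of `t ↦ (D^k Q_t)(y, α)`, `k ≤ K`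
  set c : ℕ → Fin (T₀ + 1) × Fin (T₁ + 1) → ℂ :=
    fun k ab => aeval ![y, α] (royD^[k] (monoXY ab.1 ab.2)) with hc
  set uu : Fin (K + 1) × Fin 2 → Fin (T₀ + 1) × Fin (T₁ + 1) → ℝ :=
    fun kj ab => if kj.2 = 0 then (c kj.1 ab).re else (c kj.1 ab).im with huu
  obtain ⟨t, ht0, htX, hforms⟩ := exists_ne_zero_int_forms_le uu X ℓ hℓpos
    (by simpa [Fintype.card_prod, Fintype.card_fin] using hcard)
  have hcoef : ∀ k : ℕ, k ≤ K → ∀ ab : Fin (T₀ + 1) × Fin (T₁ + 1),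
      ‖c k ab‖ ≤ K.factorial * ((1 + ‖y‖) ^ T₀ * (Real.exp 1 * (1 + ‖α‖)) ^ T₁) := by
    intro k hk ab
    have ha : (ab.1 : ℕ) ≤ T₀ := Nat.lt_succ_iff.1 ab.1.isLt
    have hb : (ab.2 : ℕ) ≤ T₁ := Nat.lt_succ_iff.1 ab.2.isLt
    have hfact : (k.factorial : ℝ) ≤ K.factorial := by exact_mod_cast Nat.factorial_le hk
    refine (norm_aeval_iterate_royD_monoXY_le k _ _ y α).trans ?_
    exact mul_le_mul hfact (mul_le_mul (pow_le_pow_right₀ h1y ha) (pow_le_pow_right₀ h1α hb)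
      (by positivity) (by positivity)) (by positivity) (by positivity)
  have hA : ∀ (k : Fin (K + 1)) (j : Fin 2), ∑ ab, |uu (k, j) ab| ≤
      (((T₀ + 1) * (T₁ + 1) : ℕ) : ℝ) *
        (K.factorial * ((1 + ‖y‖) ^ T₀ * (Real.exp 1 * (1 + ‖α‖)) ^ T₁)) := by
    intro k j
    have hk : (k : ℕ) ≤ K := Nat.lt_succ_iff.1 k.isLt
    calc ∑ ab, |uu (k, j) ab| ≤ ∑ ab, ‖c k ab‖ := Finset.sum_le_sum fun ab _ => by
          fin_cases j
          · simpa [huu] using abs_re_le_norm (c k ab)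
          · simpa [huu] using abs_im_le_norm (c k ab)
      _ ≤ ∑ _ab : Fin (T₀ + 1) × Fin (T₁ + 1),
          (K.factorial : ℝ) * ((1 + ‖y‖) ^ T₀ * (Real.exp 1 * (1 + ‖α‖)) ^ T₁) :=
          Finset.sum_le_sum fun ab _ => hcoef k hk ab
      _ = _ := by simp [Finset.sum_const, Finset.card_univ, Fintype.card_prod, Fintype.card_fin]
  -- the witness
  have htnorm : ‖t‖ ≤ (X : ℝ) := by
    refine (pi_norm_le_iff_of_nonneg (Nat.cast_nonneg X)).2 fun ab => ?_
    rw [Int.norm_eq_abs, ← Int.cast_abs]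
    exact_mod_cast htX ab
  refine ⟨polyOfCoeffs t, polyOfCoeffs_ne_zero ht0, ?_, ?_, ?_, ?_⟩
  · calc ((polyOfCoeffs t).degreeOf 0 : ℝ) ≤ (T₀ : ℝ) := by
          exact_mod_cast degreeOf_polyOfCoeffs_fst t
      _ ≤ x ^ t₀ := hT₀le
  · calc ((polyOfCoeffs t).degreeOf 1 : ℝ) ≤ (T₁ : ℝ) := by
          exact_mod_cast degreeOf_polyOfCoeffs_snd t
      _ ≤ x ^ t₁ := hT₁le
  · exact (mvPolyHeight_polyOfCoeffs_le t).trans (htnorm.trans hXle)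
  · intro k hk
    have hkK : k ≤ K := Nat.le_floor hk
    have hkK' : k < K + 1 := Nat.lt_succ_of_le hkK
    set kk : Fin (K + 1) := ⟨k, hkK'⟩ with hkk
    have hv : aeval ![y, α] (royD^[k] (polyOfCoeffs t)) = ∑ ab, (t ab : ℂ) * c k ab := by
      rw [aeval_iterate_royD_polyOfCoeffs]
    have hre : (∑ ab, (t ab : ℂ) * c k ab).re = ∑ ab, uu (kk, 0) ab * t ab := by
      rw [Complex.re_sum]
      refine Finset.sum_congr rfl fun ab _ => ?_
      simp [huu, hkk, Complex.mul_re, mul_comm]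
    have him : (∑ ab, (t ab : ℂ) * c k ab).im = ∑ ab, uu (kk, 1) ab * t ab := by
      rw [Complex.im_sum]
      refine Finset.sum_congr rfl fun ab _ => ?_
      simp [huu, hkk, Complex.mul_im, mul_comm]
    set G : ℝ := (((T₀ + 1) * (T₁ + 1) : ℕ) : ℝ) *
      (K.factorial * ((1 + ‖y‖) ^ T₀ * (Real.exp 1 * (1 + ‖α‖)) ^ T₁)) with hG
    have hG0 : 0 ≤ G := by rw [hG]; positivity
    have hform : ∀ j : Fin 2, |∑ ab, uu (kk, j) ab * t ab| ≤ (X : ℝ) * G / ℓ := fun j =>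
      (hforms (kk, j)).trans (div_le_div_of_nonneg_right
        (mul_le_mul_of_nonneg_left (hA kk j) (Nat.cast_nonneg X)) hℓposR.le)
    have hsmall : 2 * ((X : ℝ) * G / ℓ) ≤ Real.exp (-x ^ u) := by
      have hBG : 2 * ((X : ℝ) * G) = B * Real.exp (-x ^ u) := by
        rw [hB, hG, Real.exp_neg]; field_simp
      rw [show 2 * ((X : ℝ) * G / ℓ) = 2 * ((X : ℝ) * G) / ℓ by ring, hBG,
        div_le_iff₀ hℓposR]
      exact mul_comm (Real.exp (-x ^ u)) ℓ ▸
        mul_le_mul_of_nonneg_right hBℓ (Real.exp_pos _).le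
    calc ‖aeval ![y, α] (royD^[k] (polyOfCoeffs t))‖
        ≤ |(aeval ![y, α] (royD^[k] (polyOfCoeffs t))).re| +
          |(aeval ![y, α] (royD^[k] (polyOfCoeffs t))).im| := norm_le_abs_re_add_abs_im _
      _ = |∑ ab, uu (kk, 0) ab * t ab| + |∑ ab, uu (kk, 1) ab * t ab| := by rw [hv, hre, him]
      _ ≤ (X : ℝ) * G / ℓ + (X : ℝ) * G / ℓ := add_le_add (hform 0) (hform 1)
      _ = 2 * ((X : ℝ) * G / ℓ) := by ring
      _ ≤ Real.exp (-x ^ u) := hsmall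

/-- **The translates carry all the content of Roy's criterion.** For `α ≠ 0` and admissible
parameters, Roy's condition (b) (box + smallness at `(my, α^m)` for all `k ≤ N^{s₀}` and all
`1 ≤ m ≤ N^{s₁}`) holds iff `(y, α)` lies on the graph of `exp` up to torsion (Roy's Theorem 1, in
the tree), whereas its single-point part `m = 1` holds at every `(y, α)` whatsoever.
[cite: Roy2001, Thm. 1] -/
theorem roy_translates_carry_all_content (y α : ℂ) (hα : α ≠ 0) {s₀ s₁ t₀ t₁ u : ℝ}
    (h : RoyAdmissible s₀ s₁ t₀ t₁ u) :
    (RoyConditionB y α s₀ s₁ t₀ t₁ u ↔ RoyConditionA y α) ∧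
      ∀ᶠ N : ℕ in atTop, ∃ Q : MvPolynomial (Fin 2) ℤ, Q ≠ 0 ∧
        (Q.degreeOf 0 : ℝ) ≤ (N : ℝ) ^ t₀ ∧ (Q.degreeOf 1 : ℝ) ≤ (N : ℝ) ^ t₁ ∧
        (mvPolyHeight Q : ℝ) ≤ Real.exp N ∧
        ∀ k : ℕ, (k : ℝ) ≤ (N : ℝ) ^ s₀ →
          ‖aeval ![y, α] (royD^[k] Q)‖ ≤ Real.exp (-(N : ℝ) ^ u) :=
  ⟨(Roy2001_thm1_holds y α hα s₀ s₁ t₀ t₁ u h).symm, eventually_exists_roySmallAt_everywhere y α h⟩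

end Summit.Schanuel.Schanuel.Theorems

end
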